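import Literature.Probability.LatticeModels.ModifiedSimonInequality
import HarnessLib

/-!
# Reflected (folded) random currents and the switching lemma for reflected currents
# (Duminil-Copin–Panis 2025, §2.2, Lemma 2.3)

Topic `Literature/Probability/LatticeModels`; sibling of `ModifiedSimonInequality.lean`, whose
`ℝ≥0∞`-valued current framework on the edges `ℰ_Λ` of a finite volume (`cdeg`, `csources`,
`cweight`, `CSupp`, `currentZ`, `cbinom`, `switchCount`, `CConn`, `switchCount_eq_of_cconn`,
`tsum_pair_eq_tsum_cbinom`) is reused verbatim.

Duminil-Copin–Panis, *New lower bounds for the (near) critical Ising and φ⁴ models' two-point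
functions*, CMP 406 (2025) = arXiv:2404.05700, §2.2: given a reflection `𝓡` through a hyperplane
`ℍ`, "Decompose `𝐧` into its restrictions `𝐧₋`, `𝐧₊` and `𝐧₀` … Consider the multigraph `ℳ`
obtained by taking the union of the multigraph `𝒩₋` associated with `𝐧₋` and the reflection
`𝓡(𝒩₊)` of the multigraph `𝒩₊`", and **Lemma 2.3 (Switching principle for reflected currents)**:
"Let `Λ ⊂ ℤ^d` be finite and symmetric under `𝓡`. Assume that `A ⊂ Λ` and `x ∈ Λ` are strictly on
the left of `ℍ`. Then `Z^A_{Λ,β}[x ↔_ℳ ℍ] = Z^{A Δ {x, 𝓡(x)}}_{Λ,β}[x ↔_ℳ ℍ]`."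

We formalise this for an abstract *fold datum* (`IsFoldable G θ Λ H₋`): a locally finite graph
`G`, a finite volume `Λ`, an involutive graph automorphism `θ` preserving `Λ`, and a "strict left
half" `H₋ ⊆ Λ` with `θ(H₋) ∩ H₋ = ∅`, every non-fixed vertex of `Λ` in `H₋ ∪ θ(H₋)`, and no edge
from `H₋` to `θ(H₋)` (edges leaving `H₋` end in the fixed set `{θ v = v}`, the "hyperplane").
The folded current is `fold n (e) = n(e) + n(θe)` on *left* edges (those with an endpoint in
`H₋`) and `0` elsewhere, and "`x ↔_ℳ ℍ`" is `ConnFix`: `x` is joined to a fixed vertex of `Λ` by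
edges charged by `fold n`.

## Main result

`tsum_switch_reflected` (Lemma 2.3 in generating-function form, for an arbitrary source
predicate `𝒜`, an arbitrary `θ`-symmetric support `E'` and any `x ∈ H₋`):

`∑ₙ 𝟙[𝒜(∂n), n ⊆ E'] w(n) 𝟙[x ↔ Fix in fold n] = ∑ₙ 𝟙[𝒜(∂n Δ {x} Δ {θx}), n ⊆ E'] w(n) 𝟙[x ↔ Fix in fold n]`.

With `𝒜 = (· = A)` this is the printed statement. The proof follows the source: the bijection
`n ↦ (n₀, n₋, θ^*n₊)` (`tsum_decompose`), under which the weight factorises, the fold becomes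
`n₋ + θ^*n₊` and the sources become a parity functional `srcOf n₀ ∂n₋ ∂(θ^*n₊)`; the pair
`(n₋, θ^*n₊)` is resummed over its sum (`tsum_pair_eq_tsum_cbinom`) and the sources of the
sub-current are switched along a charged path from `x` to a fixed vertex
(`switchCount_eq_of_cconn`), which shifts `srcOf` by `{x, θx}` (`srcOf_switch`).

Also proved: the **handshake for reflected currents** (`connFix_fold_of_sources`): if the only
source of `n` in `H₋` is `u`, then `u` is connected to a fixed vertex in `fold n` — the fact behind
"`Z^{{0,𝓡(0)}}_{Λ,β}[0 ↔_ℳ ℍ] = Z^{{0,𝓡(0)}}_{Λ,β}`" in the proofs of DCP Lemmas 2.4 and 2.5.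
Definitions introduced (all with bodies): `IsFoldable`, `IsLeft`, `IsFoldable.edgeRefl`,
`creflect`, `fold`, `ConnFix`, `leftEdges`, `rightEdges`, `fixEdges`, `crestrict`, `recombine`,
`decompose`, `TripleSupp`, `srcOf`. No named fact.

## References

* H. Duminil-Copin, R. Panis, CMP 406 (2025), arXiv:2404.05700, §2.2 and Lemma 2.3
  [DuminilCopinPanis2025LowerBounds].
* M. Aizenman, H. Duminil-Copin, V. Tassion, S. Warzel, *Emergent planarity in two-dimensional
  Ising models with finite-range interactions*, Invent. Math. 216 (2019) (folded currents), as
  cited in DCP 2025, §2.2.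
* H. Duminil-Copin, *Random currents expansion of the Ising model*, arXiv:1607.06933, §3,
  Lemma 3.1 (switching lemma) [DuminilCopinECM2018].
-/

noncomputable section

open Finset
open scoped symmDiff ENNReal

namespace Literature.Probability.LatticeModels

variable {V : Type*} [DecidableEq V]

/-! ### Fold data -/

/-- **Fold datum** for reflected currents (DCP 2025, §2.2): a volume `Λ`, an involutive graph
automorphism `θ` of `G` preserving `Λ`, and a strict left half `H₋ ⊆ Λ`, disjoint from its
reflection, such that every non-fixed vertex of `Λ` lies in `H₋ ∪ θ(H₋)` and no edge joins `H₋`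
to `θ(H₋)` (the hyperplane of fixed vertices separates the two halves).
[cite: DuminilCopinPanis2025LowerBounds, §2.2 (reflected currents)] -/
structure IsFoldable (G : SimpleGraph V) (θ : V ≃ V) (Λ Hm : Finset V) : Prop where
  invol : Function.Involutive θ
  adj_iff : ∀ x y, G.Adj (θ x) (θ y) ↔ G.Adj x y
  mem_iff : ∀ x, θ x ∈ Λ ↔ x ∈ Λ
  left_subset : Hm ⊆ Λ
  left_disjoint : ∀ x ∈ Hm, θ x ∉ Hm
  cover : ∀ x ∈ Λ, θ x ≠ x → x ∈ Hm ∨ θ x ∈ Hm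
  no_cross : ∀ x ∈ Hm, ∀ y, G.Adj x y → θ y ∉ Hm

/-- An edge is a *left edge* if one of its endpoints lies in the strict left half `H₋`
(the edge set `E₋(ℍ)` of DCP 2025, §2.2). [cite: DuminilCopinPanis2025LowerBounds, §2.2 (the sets E₋, E₊, E₀)] -/
def IsLeft (Hm : Finset V) (e : Sym2 V) : Prop := ∃ x ∈ Hm, x ∈ e

/-- Being a left edge is decidable. [folklore] -/
instance (Hm : Finset V) : DecidablePred (IsLeft Hm) := fun _ => by
  unfold IsLeft; infer_instance

namespace IsFoldable

variable {G : SimpleGraph V} [G.LocallyFinite] {θ : V ≃ V} {Λ Hm : Finset V}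

omit [DecidableEq V] [G.LocallyFinite] in
/-- Fixed vertices are not in the strict left half. [cite: DuminilCopinPanis2025LowerBounds, §2.2 (reflected currents)] -/
theorem not_mem_of_fixed (h : IsFoldable G θ Λ Hm) {f : V} (hf : θ f = f) : f ∉ Hm :=
  fun hfm => h.left_disjoint f hfm (hf.symm ▸ hfm)

omit [DecidableEq V] [G.LocallyFinite] in
/-- Vertices of the left half are not fixed. [cite: DuminilCopinPanis2025LowerBounds, §2.2 (reflected currents)] -/
theorem apply_ne_of_mem (h : IsFoldable G θ Λ Hm) {x : V} (hx : x ∈ Hm) : θ x ≠ x :=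
  fun hfx => h.not_mem_of_fixed hfx hx

/-- `θ` maps edges of `Λ` to edges of `Λ`. [cite: DuminilCopinPanis2025LowerBounds, §2.2 (reflected currents)] -/
theorem map_mem_edgesIn (h : IsFoldable G θ Λ Hm) {e : Sym2 V} (he : e ∈ edgesIn G Λ) :
    Sym2.map θ e ∈ edgesIn G Λ := by
  induction e using Sym2.ind with
  | _ a b =>
    rw [mem_edgesIn_iff] at he ⊢
    rw [Sym2.map_mk]
    refine ⟨(SimpleGraph.mem_edgeSet G).2 ((h.adj_iff a b).2 ((SimpleGraph.mem_edgeSet G).1 he.1)),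
      fun x hx => ?_⟩
    rcases Sym2.mem_iff.1 hx with rfl | rfl
    · exact (h.mem_iff a).2 (he.2 a (Sym2.mem_mk_left a b))
    · exact (h.mem_iff b).2 (he.2 b (Sym2.mem_mk_right a b))

omit [DecidableEq V] [G.LocallyFinite] in
/-- `θ ∘ θ = id` on unordered pairs. [folklore] -/
theorem map_map (h : IsFoldable G θ Λ Hm) (e : Sym2 V) : Sym2.map θ (Sym2.map θ e) = e := by
  rw [Sym2.map_map, show ((θ : V → V) ∘ θ) = id from funext h.invol, Sym2.map_id, id]

/-- **The reflection of edges of `Λ`** as an involution of `ℰ_Λ`. [cite: DuminilCopinPanis2025LowerBounds, §2.2 (reflected currents)] -/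
def edgeRefl (h : IsFoldable G θ Λ Hm) : edgesIn G Λ ≃ edgesIn G Λ where
  toFun e := ⟨Sym2.map θ e, h.map_mem_edgesIn e.2⟩
  invFun e := ⟨Sym2.map θ e, h.map_mem_edgesIn e.2⟩
  left_inv e := Subtype.ext (h.map_map e)
  right_inv e := Subtype.ext (h.map_map e)

/-- The reflected edge, as an unordered pair. [folklore] -/
@[simp] theorem coe_edgeRefl (h : IsFoldable G θ Λ Hm) (e : edgesIn G Λ) :
    ((h.edgeRefl e : edgesIn G Λ) : Sym2 V) = Sym2.map θ e := rfl

/-- `edgeRefl` is an involution. [folklore] -/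
theorem edgeRefl_edgeRefl (h : IsFoldable G θ Λ Hm) (e : edgesIn G Λ) : h.edgeRefl (h.edgeRefl e) = e :=
  Subtype.ext (h.map_map e)

omit [DecidableEq V] [G.LocallyFinite] in
/-- Membership in a reflected pair: `v ∈ θ e ↔ θ v ∈ e`. [folklore] -/
theorem mem_map_iff (h : IsFoldable G θ Λ Hm) (v : V) (e : Sym2 V) : v ∈ Sym2.map θ e ↔ θ v ∈ e := by
  rw [Sym2.mem_map]
  constructor
  · rintro ⟨w, hw, rfl⟩; rwa [h.invol w]
  · intro hv; exact ⟨θ v, hv, h.invol v⟩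

omit [DecidableEq V] [G.LocallyFinite] in
/-- The reflection of a left edge is not a left edge (no edge crosses from `H₋` to `θ H₋`).
[cite: DuminilCopinPanis2025LowerBounds, §2.2 (the sets E₋, E₊, E₀)] -/
theorem not_isLeft_map (h : IsFoldable G θ Λ Hm) {e : Sym2 V} (he : e ∈ G.edgeSet) (hl : IsLeft Hm e) :
    ¬ IsLeft Hm (Sym2.map θ e) := by
  rintro ⟨z, hz, hze⟩
  rw [h.mem_map_iff] at hze
  obtain ⟨x, hx, hxe⟩ := hl
  induction e using Sym2.ind with
  | _ a b =>
    have hab : G.Adj a b := (SimpleGraph.mem_edgeSet G).1 he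
    -- `x` and `θ z` are endpoints of `{a, b}`, `x ∈ H₋`, `z ∈ H₋`
    rcases Sym2.mem_iff.1 hxe with rfl | rfl <;> rcases Sym2.mem_iff.1 hze with h1 | h1
    · exact h.left_disjoint z hz (h1 ▸ hx)
    · exact h.no_cross x hx b hab (by rw [← h1, h.invol z]; exact hz)
    · exact h.no_cross x hx a hab.symm (by rw [← h1, h.invol z]; exact hz)
    · exact h.left_disjoint z hz (h1 ▸ hx)

/-- **Trichotomy of edges of `Λ`**: left, reflected-left (right), or pointwise fixed.
[cite: DuminilCopinPanis2025LowerBounds, §2.2 (the sets E₋, E₊, E₀)] -/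
theorem isLeft_or (h : IsFoldable G θ Λ Hm) {e : Sym2 V} (he : e ∈ edgesIn G Λ) :
    IsLeft Hm e ∨ IsLeft Hm (Sym2.map θ e) ∨ ∀ v ∈ e, θ v = v := by
  by_cases hfix : ∀ v ∈ e, θ v = v
  · exact Or.inr (Or.inr hfix)
  · push Not at hfix
    obtain ⟨v, hve, hv⟩ := hfix
    have hvΛ : v ∈ Λ := (mem_edgesIn_iff.1 he).2 v hve
    rcases h.cover v hvΛ hv with hl | hr
    · exact Or.inl ⟨v, hl, hve⟩
    · exact Or.inr (Or.inl ⟨θ v, hr, (h.mem_map_iff _ _).2 (by rwa [h.invol v])⟩)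

omit [DecidableEq V] in
/-- Pointwise fixed edges are fixed by the edge reflection. [folklore] -/
theorem map_eq_of_fixed {e : Sym2 V} (hfix : ∀ v ∈ e, θ v = v) : Sym2.map θ e = e := by
  induction e using Sym2.ind with
  | _ a b => rw [Sym2.map_mk, hfix a (Sym2.mem_mk_left a b), hfix b (Sym2.mem_mk_right a b)]

omit [DecidableEq V] [G.LocallyFinite] in
/-- Pointwise fixed edges are not left edges. [folklore] -/
theorem not_isLeft_of_fixed (h : IsFoldable G θ Λ Hm) {e : Sym2 V} (hfix : ∀ v ∈ e, θ v = v) :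
    ¬ IsLeft Hm e := fun ⟨x, hx, hxe⟩ => h.not_mem_of_fixed (hfix x hxe) hx

/-! ### Folded and reflected currents -/

/-- The reflected current `θ^* n : e ↦ n(θ e)`. [cite: DuminilCopinPanis2025LowerBounds, §2.2 (reflected currents)] -/
def creflect (h : IsFoldable G θ Λ Hm) (n : edgesIn G Λ → ℕ) : edgesIn G Λ → ℕ :=
  fun e => n (h.edgeRefl e)

/-- **The folded current** `ℳ = 𝒩₋ ∪ 𝓡(𝒩₊)` of DCP 2025, §2.2: `fold n (e) = n(e) + n(θe)` on left
edges, `0` elsewhere. [cite: DuminilCopinPanis2025LowerBounds, §2.2 (the multigraph ℳ_n)] -/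
def fold (h : IsFoldable G θ Λ Hm) (n : edgesIn G Λ → ℕ) : edgesIn G Λ → ℕ :=
  fun e => if IsLeft Hm (e : Sym2 V) then n e + n (h.edgeRefl e) else 0

/-- **Connection to the hyperplane in the folded current**: `x` is joined to a `θ`-fixed vertex of
`Λ` through edges charged by `m` ("`x ↔_{ℳ_n} ℍ_n`", DCP 2025, §2.2; fixed vertices are connected to
the hyperplane by the empty path). [cite: DuminilCopinPanis2025LowerBounds, §2.2 (the event x ↔ ℍ in ℳ)] -/
def ConnFix (_h : IsFoldable G θ Λ Hm) (m : edgesIn G Λ → ℕ) (x : V) : Prop :=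
  ∃ f ∈ Λ, θ f = f ∧ CConn G Λ m (edgesIn G Λ) x f

/-- `θ^*` is an involution on currents. [folklore] -/
theorem creflect_creflect (h : IsFoldable G θ Λ Hm) (n : edgesIn G Λ → ℕ) : h.creflect (h.creflect n) = n := by
  funext e; simp [creflect, h.edgeRefl_edgeRefl]

/-- `θ^*` preserves weights. [folklore] -/
theorem cweight_creflect (h : IsFoldable G θ Λ Hm) (β : ℝ) (n : edgesIn G Λ → ℕ) :
    cweight G Λ β (h.creflect n) = cweight G Λ β n := by
  unfold cweight creflect
  exact Fintype.prod_equiv h.edgeRefl _ _ fun e => rfl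

/-- Degrees of the reflected current: `deg_{θ^*n}(v) = deg_n(θ v)`. [folklore] -/
theorem cdeg_creflect (h : IsFoldable G θ Λ Hm) (n : edgesIn G Λ → ℕ) (v : V) :
    cdeg G Λ (h.creflect n) v = cdeg G Λ n (θ v) := by
  unfold cdeg creflect
  rw [← Equiv.sum_comp h.edgeRefl (fun e => if θ v ∈ (e : Sym2 V) then n e else 0)]
  refine sum_congr rfl fun e _ => if_congr ?_ rfl rfl
  rw [coe_edgeRefl, h.mem_map_iff, h.invol]

/-- Degrees are additive in the current. [folklore] -/
theorem cdeg_add (a b : edgesIn G Λ → ℕ) (v : V) : cdeg G Λ (a + b) v = cdeg G Λ a v + cdeg G Λ b v := by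
  unfold cdeg
  rw [← sum_add_distrib]
  exact sum_congr rfl fun e _ => by split_ifs <;> simp

/-- Connections charged by a current supported in `E''` run through edges of `E''`. [folklore] -/
theorem cconn_of_csupp {m : edgesIn G Λ → ℕ} {E'' : Finset (Sym2 V)} (hsupp : CSupp G Λ E'' m)
    {u v : V} (huv : CConn G Λ m (edgesIn G Λ) u v) : CConn G Λ m E'' u v := by
  induction huv with
  | refl => exact Relation.ReflTransGen.refl
  | tail _ hbc ih =>
    obtain ⟨e, _, hpos, hes⟩ := hbc
    exact ih.tail ⟨e, hsupp e hpos.ne', hpos, hes⟩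

/-- A left edge is neither right nor fixed. [folklore] -/
theorem left_excl (h : IsFoldable G θ Λ Hm) {e : edgesIn G Λ} (hl : IsLeft Hm (e : Sym2 V)) :
    ¬ IsLeft Hm (Sym2.map θ e) ∧ ¬ ∀ v ∈ (e : Sym2 V), θ v = v :=
  ⟨h.not_isLeft_map (mem_edgesIn_iff.1 e.2).1 hl, fun hfix => h.not_isLeft_of_fixed hfix hl⟩

/-- A right edge is neither left nor fixed. [folklore] -/
theorem right_excl (h : IsFoldable G θ Λ Hm) {e : edgesIn G Λ} (hr : IsLeft Hm (Sym2.map θ e)) :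
    ¬ IsLeft Hm (e : Sym2 V) ∧ ¬ ∀ v ∈ (e : Sym2 V), θ v = v := by
  refine ⟨fun hl => (h.left_excl hl).1 hr, fun hfix => ?_⟩
  rw [map_eq_of_fixed hfix] at hr
  exact h.not_isLeft_of_fixed hfix hr

/-- A fixed edge is neither left nor right. [folklore] -/
theorem fixed_excl (h : IsFoldable G θ Λ Hm) {e : edgesIn G Λ} (hfix : ∀ v ∈ (e : Sym2 V), θ v = v) :
    ¬ IsLeft Hm (e : Sym2 V) ∧ ¬ IsLeft Hm (Sym2.map θ e) := by
  refine ⟨h.not_isLeft_of_fixed hfix, ?_⟩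
  rw [map_eq_of_fixed hfix]
  exact h.not_isLeft_of_fixed hfix

/-! ### The three edge classes and the decomposition of current sums -/

/-- Left edges of `Λ` (`E₋`). [cite: DuminilCopinPanis2025LowerBounds, §2.2 (the sets E₋, E₊, E₀)] -/
def leftEdges (_h : IsFoldable G θ Λ Hm) : Finset (Sym2 V) := (edgesIn G Λ).filter (IsLeft Hm)

/-- Right edges of `Λ` (`E₊ = θ E₋`). [cite: DuminilCopinPanis2025LowerBounds, §2.2 (the sets E₋, E₊, E₀)] -/
def rightEdges (_h : IsFoldable G θ Λ Hm) : Finset (Sym2 V) :=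
  (edgesIn G Λ).filter fun e => IsLeft Hm (Sym2.map θ e)

/-- Pointwise fixed edges of `Λ` (`E₀`): the edges that are neither left nor right.
[cite: DuminilCopinPanis2025LowerBounds, §2.2 (the sets E₋, E₊, E₀)] -/
def fixEdges (_h : IsFoldable G θ Λ Hm) : Finset (Sym2 V) :=
  (edgesIn G Λ).filter fun e => ¬ IsLeft Hm e ∧ ¬ IsLeft Hm (Sym2.map θ e)

/-- Restriction of a current to an edge set. [folklore] -/
def crestrict (E' : Finset (Sym2 V)) (n : edgesIn G Λ → ℕ) : edgesIn G Λ → ℕ :=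
  fun e => if (e : Sym2 V) ∈ E' then n e else 0

/-- The recombination map `(n₀, n₁, n₂) ↦ n₀ + n₁ + θ^* n₂`. [cite: DuminilCopinPanis2025LowerBounds, §2.2 (decomposition n = n₋ + n₊ + n₀)] -/
def recombine (h : IsFoldable G θ Λ Hm) (t : (edgesIn G Λ → ℕ) × (edgesIn G Λ → ℕ) × (edgesIn G Λ → ℕ)) :
    edgesIn G Λ → ℕ :=
  t.1 + t.2.1 + h.creflect t.2.2

/-- The decomposition map `n ↦ (n|E₀, n|E₋, θ^*(n|E₊))`. [cite: DuminilCopinPanis2025LowerBounds, §2.2 (decomposition n = n₋ + n₊ + n₀)] -/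
def decompose (h : IsFoldable G θ Λ Hm) (n : edgesIn G Λ → ℕ) :
    (edgesIn G Λ → ℕ) × (edgesIn G Λ → ℕ) × (edgesIn G Λ → ℕ) :=
  (crestrict h.fixEdges n, crestrict h.leftEdges n, h.creflect (crestrict h.rightEdges n))

/-- The support condition of a decomposed triple: `n₀ ⊆ E₀`, `n₁, n₂ ⊆ E₋`. [folklore] -/
def TripleSupp (h : IsFoldable G θ Λ Hm) (t : (edgesIn G Λ → ℕ) × (edgesIn G Λ → ℕ) × (edgesIn G Λ → ℕ)) : Prop :=
  CSupp G Λ h.fixEdges t.1 ∧ CSupp G Λ h.leftEdges t.2.1 ∧ CSupp G Λ h.leftEdges t.2.2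

section EdgeClasses

variable (h : IsFoldable G θ Λ Hm)

/-- Membership in `E₋`. [folklore] -/
theorem mem_leftEdges (e : edgesIn G Λ) : (e : Sym2 V) ∈ h.leftEdges ↔ IsLeft Hm (e : Sym2 V) := by
  simp [leftEdges]

/-- Membership in `E₊`. [folklore] -/
theorem mem_rightEdges (e : edgesIn G Λ) : (e : Sym2 V) ∈ h.rightEdges ↔ IsLeft Hm (Sym2.map θ e) := by
  simp [rightEdges]

/-- Membership in `E₀`: by the trichotomy, exactly the pointwise fixed edges. [folklore] -/
theorem mem_fixEdges (e : edgesIn G Λ) : (e : Sym2 V) ∈ h.fixEdges ↔ ∀ v ∈ (e : Sym2 V), θ v = v := by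
  simp only [fixEdges, mem_filter, e.2, true_and]
  constructor
  · rintro ⟨h1, h2⟩
    rcases h.isLeft_or e.2 with hl | hr | hf
    · exact absurd hl h1
    · exact absurd hr h2
    · exact hf
  · exact fun hf => h.fixed_excl hf

/-- The reflection of a right edge is a left edge. [folklore] -/
theorem isLeft_map_edgeRefl_iff (e : edgesIn G Λ) :
    IsLeft Hm (Sym2.map θ ((h.edgeRefl e : edgesIn G Λ) : Sym2 V)) ↔ IsLeft Hm (e : Sym2 V) := by
  rw [coe_edgeRefl, h.map_map]

/-- **The decomposition inverts the recombination** on supported triples. [folklore] -/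
theorem decompose_recombine {t : (edgesIn G Λ → ℕ) × (edgesIn G Λ → ℕ) × (edgesIn G Λ → ℕ)}
    (ht : h.TripleSupp t) : h.decompose (h.recombine t) = t := by
  obtain ⟨n₀, n₁, n₂⟩ := t
  obtain ⟨h0, h1, h2⟩ := ht
  -- support facts, pointwise
  have s0 : ∀ e : edgesIn G Λ, ¬ (∀ v ∈ (e : Sym2 V), θ v = v) → n₀ e = 0 := fun e he => by
    by_contra hne; exact he ((h.mem_fixEdges e).1 (h0 e hne))
  have s1 : ∀ e : edgesIn G Λ, ¬ IsLeft Hm (e : Sym2 V) → n₁ e = 0 := fun e he => by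
    by_contra hne; exact he ((h.mem_leftEdges e).1 (h1 e hne))
  have s2 : ∀ e : edgesIn G Λ, ¬ IsLeft Hm (e : Sym2 V) → n₂ e = 0 := fun e he => by
    by_contra hne; exact he ((h.mem_leftEdges e).1 (h2 e hne))
  simp only [decompose, recombine, Prod.mk.injEq]
  refine ⟨?_, ?_, ?_⟩
  · funext e
    simp only [crestrict, Pi.add_apply, creflect]
    by_cases he : (e : Sym2 V) ∈ h.fixEdges
    · rw [if_pos he]
      have hfix := (h.mem_fixEdges e).1 he
      rw [s1 e (h.fixed_excl hfix).1, s2 (h.edgeRefl e) (by rw [coe_edgeRefl]; exact (h.fixed_excl hfix).2)]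
      simp
    · rw [if_neg he, s0 e (fun hf => he ((h.mem_fixEdges e).2 hf))]
  · funext e
    simp only [crestrict, Pi.add_apply, creflect]
    by_cases he : (e : Sym2 V) ∈ h.leftEdges
    · rw [if_pos he]
      have hl := (h.mem_leftEdges e).1 he
      rw [s0 e (h.left_excl hl).2, s2 (h.edgeRefl e) (by rw [coe_edgeRefl]; exact (h.left_excl hl).1)]
      ring
    · rw [if_neg he, s1 e (fun hl => he ((h.mem_leftEdges e).2 hl))]
  · funext e
    simp only [crestrict, Pi.add_apply, creflect, h.edgeRefl_edgeRefl]
    by_cases hl : IsLeft Hm (e : Sym2 V)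
    · have hr : ((h.edgeRefl e : edgesIn G Λ) : Sym2 V) ∈ h.rightEdges := by
        rw [h.mem_rightEdges, h.isLeft_map_edgeRefl_iff]; exact hl
      rw [if_pos hr]
      have hnl : ¬ IsLeft Hm ((h.edgeRefl e : edgesIn G Λ) : Sym2 V) := by
        rw [coe_edgeRefl]; exact (h.left_excl hl).1
      have hnf : ¬ ∀ v ∈ ((h.edgeRefl e : edgesIn G Λ) : Sym2 V), θ v = v := by
        intro hfix
        apply (h.left_excl hl).2
        intro v hv
        have hmap : Sym2.map θ ((h.edgeRefl e : edgesIn G Λ) : Sym2 V) = (e : Sym2 V) := by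
          rw [coe_edgeRefl, h.map_map]
        apply hfix v
        rw [← map_eq_of_fixed hfix, hmap]; exact hv
      rw [s0 _ hnf, s1 _ hnl]; ring
    · have hr : ((h.edgeRefl e : edgesIn G Λ) : Sym2 V) ∉ h.rightEdges := by
        rw [h.mem_rightEdges, h.isLeft_map_edgeRefl_iff]; exact hl
      rw [if_neg hr, s2 e hl]

/-- **The recombination inverts the decomposition** (trichotomy of edges). [folklore] -/
theorem recombine_decompose (n : edgesIn G Λ → ℕ) : h.recombine (h.decompose n) = n := by
  funext e
  simp only [recombine, decompose, Pi.add_apply, creflect, crestrict, h.edgeRefl_edgeRefl]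
  rcases h.isLeft_or e.2 with hl | hr | hf
  · rw [if_neg (mt (h.mem_fixEdges e).1 (h.left_excl hl).2), if_pos ((h.mem_leftEdges e).2 hl),
      if_neg (mt (h.mem_rightEdges e).1 (h.left_excl hl).1)]
    simp
  · rw [if_neg (mt (h.mem_fixEdges e).1 (h.right_excl hr).2), if_neg (mt (h.mem_leftEdges e).1 (h.right_excl hr).1),
      if_pos ((h.mem_rightEdges e).2 hr)]
    simp
  · rw [if_pos ((h.mem_fixEdges e).2 hf), if_neg (mt (h.mem_leftEdges e).1 (h.fixed_excl hf).1),
      if_neg (mt (h.mem_rightEdges e).1 (h.fixed_excl hf).2)]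
    simp

/-- The decomposed triple is supported. [folklore] -/
theorem tripleSupp_decompose (n : edgesIn G Λ → ℕ) : h.TripleSupp (h.decompose n) := by
  refine ⟨fun e hne => ?_, fun e hne => ?_, fun e hne => ?_⟩
  · simp only [decompose, crestrict] at hne
    by_contra he; exact hne (by rw [if_neg he])
  · simp only [decompose, crestrict] at hne
    by_contra he; exact hne (by rw [if_neg he])
  · simp only [decompose, crestrict, creflect] at hne
    by_contra he
    apply hne
    rw [if_neg]
    rw [h.mem_rightEdges, h.isLeft_map_edgeRefl_iff]
    exact fun hl => he ((h.mem_leftEdges e).2 hl)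

/-- `decompose` is injective. [folklore] -/
theorem decompose_injective : Function.Injective h.decompose := fun n n' hnn' => by
  rw [← h.recombine_decompose n, ← h.recombine_decompose n', hnn']

/-- **Decomposition of current sums** (`ℝ≥0∞`): `∑ₙ F(n) = ∑_{(n₀,n₁,n₂) supported} F(n₀ + n₁ + θ^*n₂)`.
[cite: DuminilCopinPanis2025LowerBounds, §2.2 (decomposition n = n₋ + n₊ + n₀)] -/
theorem tsum_decompose (F : (edgesIn G Λ → ℕ) → ℝ≥0∞) :
    ∑' n, F n = ∑' t, ind (h.TripleSupp t) * F (h.recombine t) := by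
  set g : (edgesIn G Λ → ℕ) × (edgesIn G Λ → ℕ) × (edgesIn G Λ → ℕ) → ℝ≥0∞ :=
    fun t => ind (h.TripleSupp t) * F (h.recombine t) with hg
  have hsupp : Function.support g ⊆ Set.range h.decompose := by
    intro t ht
    have hts : h.TripleSupp t := by
      by_contra hn; exact ht (by simp [hg, ind_of_false hn])
    exact ⟨h.recombine t, h.decompose_recombine hts⟩
  calc ∑' n, F n = ∑' n, g (h.decompose n) := by
        refine tsum_congr fun n => ?_
        simp only [hg]
        rw [ind_of_true (h.tripleSupp_decompose n), one_mul, h.recombine_decompose]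
    _ = ∑' t, g t := h.decompose_injective.tsum_eq hsupp

end EdgeClasses

/-! ### Weights, degrees, sources, fold and support of a recombined current -/

section Recombine

variable (h : IsFoldable G θ Λ Hm)

/-- **Weights factorise** over the decomposition: `w(n₀ + n₁ + θ^*n₂) = w(n₀) w(n₁) w(n₂)` for a
supported triple (disjoint supports; `θ^*` preserves weights). [cite: DuminilCopinPanis2025LowerBounds, §2.2 (w(n) = w(n₀) w(n₋) w(n₊))] -/
theorem cweight_recombine {t : (edgesIn G Λ → ℕ) × (edgesIn G Λ → ℕ) × (edgesIn G Λ → ℕ)}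
    (ht : h.TripleSupp t) (β : ℝ) :
    cweight G Λ β (h.recombine t) = cweight G Λ β t.1 * cweight G Λ β t.2.1 * cweight G Λ β t.2.2 := by
  obtain ⟨n₀, n₁, n₂⟩ := t
  obtain ⟨h0, h1, h2⟩ := ht
  have s0 : ∀ e : edgesIn G Λ, ¬ (∀ v ∈ (e : Sym2 V), θ v = v) → n₀ e = 0 := fun e he => by
    by_contra hne; exact he ((h.mem_fixEdges e).1 (h0 e hne))
  have s1 : ∀ e : edgesIn G Λ, ¬ IsLeft Hm (e : Sym2 V) → n₁ e = 0 := fun e he => by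
    by_contra hne; exact he ((h.mem_leftEdges e).1 (h1 e hne))
  have s2 : ∀ e : edgesIn G Λ, ¬ IsLeft Hm (e : Sym2 V) → n₂ e = 0 := fun e he => by
    by_contra hne; exact he ((h.mem_leftEdges e).1 (h2 e hne))
  rw [← h.cweight_creflect β n₂]
  simp only [recombine, cweight]
  rw [← prod_mul_distrib, ← prod_mul_distrib]
  refine prod_congr rfl fun e _ => ?_
  simp only [Pi.add_apply, creflect]
  rcases h.isLeft_or e.2 with hl | hr | hf
  · rw [s0 e (h.left_excl hl).2, s2 (h.edgeRefl e) (by rw [coe_edgeRefl]; exact (h.left_excl hl).1)]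
    simp
  · rw [s0 e (h.right_excl hr).2, s1 e (h.right_excl hr).1]
    simp
  · rw [s1 e (h.fixed_excl hf).1, s2 (h.edgeRefl e) (by rw [coe_edgeRefl]; exact (h.fixed_excl hf).2)]
    simp

/-- Degrees of a recombined current: `deg(v) = deg_{n₀}(v) + deg_{n₁}(v) + deg_{n₂}(θ v)`. [folklore] -/
theorem cdeg_recombine (t : (edgesIn G Λ → ℕ) × (edgesIn G Λ → ℕ) × (edgesIn G Λ → ℕ)) (v : V) :
    cdeg G Λ (h.recombine t) v = cdeg G Λ t.1 v + cdeg G Λ t.2.1 v + cdeg G Λ t.2.2 (θ v) := by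
  simp only [recombine, cdeg_add, h.cdeg_creflect]

/-- Sources of a sum of currents: `∂(a + b) = ∂a ∆ ∂b`. [folklore] -/
theorem csources_add' (a b : edgesIn G Λ → ℕ) : csources G Λ (a + b) = csources G Λ a ∆ csources G Λ b := by
  ext v
  simp only [csources, mem_filter, mem_symmDiff, cdeg_add, Nat.odd_add]
  rcases Nat.even_or_odd (cdeg G Λ b v) with he | ho
  · have := Nat.not_odd_iff_even.2 he; tauto
  · have := Nat.not_even_iff_odd.2 ho; tauto

/-- Sources of the reflected current: `∂(θ^* n) = θ(∂n)`. [folklore] -/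
theorem csources_creflect (n : edgesIn G Λ → ℕ) : csources G Λ (h.creflect n) = (csources G Λ n).image θ := by
  ext v
  simp only [csources, mem_filter, mem_image, h.cdeg_creflect]
  constructor
  · rintro ⟨hv, ho⟩
    exact ⟨θ v, ⟨(h.mem_iff v).2 hv, ho⟩, h.invol v⟩
  · rintro ⟨w, ⟨hw, ho⟩, rfl⟩
    rw [h.invol w]
    exact ⟨(h.mem_iff w).2 hw, ho⟩

/-- **The source functional of the decomposition**: `∂n₀ ∆ B₁ ∆ θ(B₂)`; with `B₁ = ∂n₁`, `B₂ = ∂n₂`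
these are the sources of `n₀ + n₁ + θ^*n₂`. [cite: DuminilCopinPanis2025LowerBounds, §2.2 (sources of n₋, n₊, n₀)] -/
def srcOf (_h : IsFoldable G θ Λ Hm) (n₀ : edgesIn G Λ → ℕ) (B₁ B₂ : Finset V) : Finset V :=
  csources G Λ n₀ ∆ B₁ ∆ B₂.image θ

/-- **Sources of a recombined current** are given by the source functional of the sources of the
parts. [cite: DuminilCopinPanis2025LowerBounds, §2.2 (sources of n₋, n₊, n₀)] -/
theorem csources_recombine (t : (edgesIn G Λ → ℕ) × (edgesIn G Λ → ℕ) × (edgesIn G Λ → ℕ)) :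
    csources G Λ (h.recombine t) = h.srcOf t.1 (csources G Λ t.2.1) (csources G Λ t.2.2) := by
  simp only [recombine, srcOf, csources_add', h.csources_creflect]

/-- **The fold of a recombined current is `n₁ + n₂`.** [cite: DuminilCopinPanis2025LowerBounds, §2.2 (ℳ_n = 𝒩₋ ∪ 𝓡(𝒩₊))] -/
theorem fold_recombine {t : (edgesIn G Λ → ℕ) × (edgesIn G Λ → ℕ) × (edgesIn G Λ → ℕ)}
    (ht : h.TripleSupp t) : h.fold (h.recombine t) = t.2.1 + t.2.2 := by
  obtain ⟨n₀, n₁, n₂⟩ := t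
  obtain ⟨h0, h1, h2⟩ := ht
  have s0 : ∀ e : edgesIn G Λ, ¬ (∀ v ∈ (e : Sym2 V), θ v = v) → n₀ e = 0 := fun e he => by
    by_contra hne; exact he ((h.mem_fixEdges e).1 (h0 e hne))
  have s1 : ∀ e : edgesIn G Λ, ¬ IsLeft Hm (e : Sym2 V) → n₁ e = 0 := fun e he => by
    by_contra hne; exact he ((h.mem_leftEdges e).1 (h1 e hne))
  have s2 : ∀ e : edgesIn G Λ, ¬ IsLeft Hm (e : Sym2 V) → n₂ e = 0 := fun e he => by
    by_contra hne; exact he ((h.mem_leftEdges e).1 (h2 e hne))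
  funext e
  simp only [fold, recombine, Pi.add_apply, creflect, h.edgeRefl_edgeRefl]
  by_cases hl : IsLeft Hm (e : Sym2 V)
  · rw [if_pos hl]
    have hnl : ¬ IsLeft Hm ((h.edgeRefl e : edgesIn G Λ) : Sym2 V) := by
      rw [coe_edgeRefl]; exact (h.left_excl hl).1
    have hnf : ¬ ∀ v ∈ ((h.edgeRefl e : edgesIn G Λ) : Sym2 V), θ v = v := by
      intro hfix
      apply (h.left_excl hl).2
      intro v hv
      have hmap : Sym2.map θ ((h.edgeRefl e : edgesIn G Λ) : Sym2 V) = (e : Sym2 V) := by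
        rw [coe_edgeRefl, h.map_map]
      apply hfix v
      rw [← map_eq_of_fixed hfix, hmap]; exact hv
    rw [s0 e (h.left_excl hl).2, s2 (h.edgeRefl e) hnl, s0 (h.edgeRefl e) hnf, s1 (h.edgeRefl e) hnl]
    ring
  · rw [if_neg hl, s1 e hl, s2 e hl]

/-- **Support in a `θ`-symmetric edge set** passes through the decomposition. [folklore] -/
theorem csupp_recombine_iff {E' : Finset (Sym2 V)} (hE' : ∀ e ∈ edgesIn G Λ, e ∈ E' ↔ Sym2.map θ e ∈ E')
    (t : (edgesIn G Λ → ℕ) × (edgesIn G Λ → ℕ) × (edgesIn G Λ → ℕ)) :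
    CSupp G Λ E' (h.recombine t) ↔ CSupp G Λ E' t.1 ∧ CSupp G Λ E' t.2.1 ∧ CSupp G Λ E' t.2.2 := by
  obtain ⟨n₀, n₁, n₂⟩ := t
  simp only [CSupp, recombine, Pi.add_apply, creflect]
  constructor
  · intro hs
    refine ⟨fun e he => hs e (by omega), fun e he => hs e (by omega), fun e he => ?_⟩
    have := hs (h.edgeRefl e) (by rw [h.edgeRefl_edgeRefl]; omega)
    rw [coe_edgeRefl] at this
    exact (hE' e e.2).2 this
  · rintro ⟨hs0, hs1, hs2⟩ e he
    rcases Nat.eq_zero_or_pos (n₂ (h.edgeRefl e)) with hz | hpos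
    · rw [hz] at he
      rcases Nat.eq_zero_or_pos (n₀ e) with hz0 | hpos0
      · exact hs1 e (by omega)
      · exact hs0 e hpos0.ne'
    · have := hs2 (h.edgeRefl e) hpos.ne'
      rw [coe_edgeRefl] at this
      exact (hE' e e.2).2 this

/-- Support in an intersection. [folklore] -/
theorem csupp_inter_iff (A B : Finset (Sym2 V)) (n : edgesIn G Λ → ℕ) :
    CSupp G Λ (A ∩ B) n ↔ CSupp G Λ A n ∧ CSupp G Λ B n := by
  simp only [CSupp, mem_inter]
  exact ⟨fun hs => ⟨fun e he => (hs e he).1, fun e he => (hs e he).2⟩, fun hs e he => ⟨hs.1 e he, hs.2 e he⟩⟩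

end Recombine

/-! ### The switching lemma for reflected currents -/

section Switching

variable (h : IsFoldable G θ Λ Hm)

/-- Support of a difference below a supported current. [folklore] -/
theorem csupp_tsub {E'' : Finset (Sym2 V)} {m : edgesIn G Λ → ℕ} (hm : CSupp G Λ E'' m) (n : edgesIn G Λ → ℕ) :
    CSupp G Λ E'' (m - n) := fun e he => hm e (by
  have : (m - n) e = m e - n e := rfl
  omega)

/-- Support of a current from the supports of a sub-current and the difference. [folklore] -/
theorem csupp_of_tsub {E'' : Finset (Sym2 V)} {m n : edgesIn G Λ → ℕ}
    (h1 : CSupp G Λ E'' (m - n)) (h2 : CSupp G Λ E'' n) : CSupp G Λ E'' m := fun e he => by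
  by_cases hn : n e = 0
  · exact h1 e (by have : (m - n) e = m e - n e := rfl; omega)
  · exact h2 e hn

/-- **The key resummation.** For a source predicate `𝒜`, a `θ`-symmetric support `E'`, a vertex `x`
and `β ≥ 0`: the sum `∑ₙ 𝟙[𝒜(∂n), n ⊆ E'] w(n) 𝟙[x ↔ Fix in fold n]` equals the sum over the fixed
part `n₀` and the folded multigraph `m` of `w(n₀) w(m) 𝟙[m ⊆ E₋ ∩ E', x ↔ Fix in m]` times the
binomially weighted count `∑_B 𝟙[𝒜(srcOf n₀ (∂m ∆ B) B)] N_m(E₋ ∩ E', B)` of sub-currents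
(DCP 2025, proof of Lemma 2.3: "we condition on the sources of `𝐧₋` and `𝐧₊` … `∑_{𝒩 ⊂ ℳ, ∂𝒩 = D} 1`").
[cite: DuminilCopinPanis2025LowerBounds, Lemma 2.3 (proof)] -/
theorem tsum_fold_key (𝒜 : Finset V → Prop) {E' : Finset (Sym2 V)}
    (hE' : ∀ e ∈ edgesIn G Λ, e ∈ E' ↔ Sym2.map θ e ∈ E') (x : V) {β : ℝ} (hβ : 0 ≤ β) :
    ∑' n, ind (𝒜 (csources G Λ n) ∧ CSupp G Λ E' n) * cweight G Λ β n * ind (h.ConnFix (h.fold n) x) =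
      ∑' n₀, ind (CSupp G Λ h.fixEdges n₀ ∧ CSupp G Λ E' n₀) * cweight G Λ β n₀ *
        ∑' m, cweight G Λ β m * (ind (CSupp G Λ (h.leftEdges ∩ E') m ∧ h.ConnFix m x) *
          ∑ B ∈ Λ.powerset, ind (𝒜 (h.srcOf n₀ (csources G Λ m ∆ B) B)) *
            switchCount G Λ m (h.leftEdges ∩ E') B) := by
  classical
  have hsub : ∀ a b : edgesIn G Λ → ℕ, a + b - b = a := fun a b => funext fun e => by simp
  set E'' : Finset (Sym2 V) := h.leftEdges ∩ E' with hE''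
  -- the pair functional, for a fixed `n₀`
  set Φ : (edgesIn G Λ → ℕ) → (edgesIn G Λ → ℕ) → (edgesIn G Λ → ℕ) → ℝ≥0∞ := fun n₀ m n =>
    ind (CSupp G Λ E'' (m - n) ∧ CSupp G Λ E'' n ∧ 𝒜 (h.srcOf n₀ (csources G Λ (m - n)) (csources G Λ n))) *
      ind (h.ConnFix m x) with hΦ
  -- Step 1: decompose and rewrite the summand
  have step1 : ∑' n, ind (𝒜 (csources G Λ n) ∧ CSupp G Λ E' n) * cweight G Λ β n * ind (h.ConnFix (h.fold n) x) =
      ∑' t : (edgesIn G Λ → ℕ) × (edgesIn G Λ → ℕ) × (edgesIn G Λ → ℕ),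
        ind (CSupp G Λ h.fixEdges t.1 ∧ CSupp G Λ E' t.1) * cweight G Λ β t.1 *
          (cweight G Λ β t.2.1 * cweight G Λ β t.2.2 * Φ t.1 (t.2.1 + t.2.2) t.2.2) := by
    rw [h.tsum_decompose]
    refine tsum_congr fun t => ?_
    by_cases ht : h.TripleSupp t
    · rw [ind_of_true ht, one_mul, h.cweight_recombine ht, h.fold_recombine ht, h.csources_recombine,
        hΦ]
      simp only [hsub]
      obtain ⟨ht0, ht1, ht2⟩ := ht
      -- compare the indicators
      have hind : ind (𝒜 (h.srcOf t.1 (csources G Λ t.2.1) (csources G Λ t.2.2)) ∧ CSupp G Λ E' (h.recombine t)) =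
          ind (CSupp G Λ h.fixEdges t.1 ∧ CSupp G Λ E' t.1) *
            ind (CSupp G Λ E'' t.2.1 ∧ CSupp G Λ E'' t.2.2 ∧ 𝒜 (h.srcOf t.1 (csources G Λ t.2.1) (csources G Λ t.2.2))) := by
        rw [← ind_and]
        refine ind_congr ?_
        rw [h.csupp_recombine_iff hE', hE'', csupp_inter_iff, csupp_inter_iff]
        tauto
      rw [hind]
      ring
    · rw [ind_of_false ht, zero_mul]
      -- the right side vanishes: one of the supports fails
      by_cases ht0 : CSupp G Λ h.fixEdges t.1
      · have ht12 : ¬ (CSupp G Λ E'' t.2.1 ∧ CSupp G Λ E'' t.2.2 ∧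
            𝒜 (h.srcOf t.1 (csources G Λ (t.2.1 + t.2.2 - t.2.2)) (csources G Λ t.2.2))) := by
          rintro ⟨h1, h2, -⟩
          rw [hE'', csupp_inter_iff] at h1 h2
          exact ht ⟨ht0, h1.1, h2.1⟩
        rw [hΦ]; dsimp only
        rw [hsub] at ht12 ⊢
        rw [ind_of_false ht12, zero_mul, mul_zero, mul_zero]
      · rw [ind_of_false (fun hh => ht0 hh.1), zero_mul, zero_mul]
  -- Step 2: split the triple sum, pull out `n₀`, resum the pair
  rw [step1, ENNReal.tsum_prod']
  refine tsum_congr fun n₀ => ?_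
  dsimp only
  rw [ENNReal.tsum_mul_left]
  congr 1
  rw [tsum_pair_eq_tsum_cbinom G Λ hβ (Φ n₀)]
  refine tsum_congr fun m => ?_
  congr 1
  -- Step 3: the inner sum over sub-currents, for a fixed multigraph `m`
  by_cases hc : CSupp G Λ E'' m ∧ h.ConnFix m x
  · rw [ind_of_true hc, one_mul]
    -- partition by the sources `B` of the sub-current
    have hpt : ∀ n, cbinom G Λ m n * Φ n₀ m n =
        ∑ B ∈ Λ.powerset, ind (𝒜 (h.srcOf n₀ (csources G Λ m ∆ B) B)) *
          (cbinom G Λ m n * ind (CSupp G Λ E'' n ∧ csources G Λ n = B)) := by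
      intro n
      by_cases hC : cbinom G Λ m n = 0
      · rw [hC, zero_mul]
        exact (Finset.sum_eq_zero fun B _ => by rw [zero_mul, mul_zero]).symm
      · have hle : n ≤ m := fun e => le_of_cbinom_ne_zero hC e
        have hB : csources G Λ n ∈ Λ.powerset := mem_powerset.2 (filter_subset _ _)
        rw [← Finset.sum_erase_add _ _ hB, Finset.sum_eq_zero (fun B hB' => ?_), zero_add]
        · have hΦn : Φ n₀ m n =
              ind (CSupp G Λ E'' n ∧ 𝒜 (h.srcOf n₀ (csources G Λ m ∆ csources G Λ n) (csources G Λ n))) := by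
            rw [hΦ]; dsimp only
            rw [ind_of_true hc.2, mul_one, csources_tsub hle]
            exact ind_congr ⟨fun hh => ⟨hh.2.1, hh.2.2⟩, fun hh => ⟨csupp_tsub hc.1 n, hh.1, hh.2⟩⟩
          rw [hΦn]
          set S : Finset V := h.srcOf n₀ (csources G Λ m ∆ csources G Λ n) (csources G Λ n) with hS
          by_cases hs : CSupp G Λ E'' n
          · by_cases hA : 𝒜 S
            · rw [ind_of_true (P := CSupp G Λ E'' n ∧ 𝒜 S) ⟨hs, hA⟩, ind_of_true hA,
                ind_of_true (P := CSupp G Λ E'' n ∧ csources G Λ n = csources G Λ n) ⟨hs, rfl⟩, mul_one, one_mul]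
            · rw [ind_of_false (P := CSupp G Λ E'' n ∧ 𝒜 S) (fun hh => hA hh.2), ind_of_false hA, mul_zero, zero_mul]
          · rw [ind_of_false (P := CSupp G Λ E'' n ∧ 𝒜 S) (fun hh => hs hh.1),
              ind_of_false (P := CSupp G Λ E'' n ∧ csources G Λ n = csources G Λ n) (fun hh => hs hh.1),
              mul_zero, mul_zero]
        · rw [ind_of_false (P := CSupp G Λ E'' n ∧ csources G Λ n = B)
            (fun hh => (Finset.mem_erase.1 hB').1 hh.2.symm), mul_zero, mul_zero]
    calc ∑' n, cbinom G Λ m n * Φ n₀ m n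
        = ∑' n, ∑ B ∈ Λ.powerset, ind (𝒜 (h.srcOf n₀ (csources G Λ m ∆ B) B)) *
            (cbinom G Λ m n * ind (CSupp G Λ E'' n ∧ csources G Λ n = B)) := tsum_congr hpt
      _ = ∑ B ∈ Λ.powerset, ∑' n, ind (𝒜 (h.srcOf n₀ (csources G Λ m ∆ B) B)) *
            (cbinom G Λ m n * ind (CSupp G Λ E'' n ∧ csources G Λ n = B)) :=
          Summable.tsum_finsetSum (fun _ _ => ENNReal.summable)
      _ = ∑ B ∈ Λ.powerset, ind (𝒜 (h.srcOf n₀ (csources G Λ m ∆ B) B)) * switchCount G Λ m E'' B := by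
          refine sum_congr rfl fun B _ => ?_
          rw [ENNReal.tsum_mul_left]; rfl
  · rw [ind_of_false hc, zero_mul]
    refine ENNReal.tsum_eq_zero.2 fun n => ?_
    by_cases hC : cbinom G Λ m n = 0
    · rw [hC, zero_mul]
    · have hle : n ≤ m := fun e => le_of_cbinom_ne_zero hC e
      rw [hΦ]; dsimp only
      by_cases hcf : h.ConnFix m x
      · have hns : ¬ (CSupp G Λ E'' (m - n) ∧ CSupp G Λ E'' n ∧
            𝒜 (h.srcOf n₀ (csources G Λ (m - n)) (csources G Λ n))) := fun hh =>
          hc ⟨csupp_of_tsub hh.1 hh.2.1, hcf⟩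
        rw [ind_of_false hns, zero_mul, mul_zero]
      · rw [ind_of_false hcf, mul_zero, mul_zero]

/-- **Switching shifts the source functional by `{x, θx}`**: for a fixed vertex `f` and `x ∈ H₋`,
`srcOf n₀ (B₁ ∆ {x,f}) (B₂ ∆ {x,f}) = srcOf n₀ B₁ B₂ ∆ {x, θx}` (the reflected sources of the
switched sub-current: `∂𝐧₊ = D ∆ {𝓡(x), α}` in the proof of DCP Lemma 2.3).
[cite: DuminilCopinPanis2025LowerBounds, Lemma 2.3 (proof)] -/
theorem srcOf_switch (n₀ : edgesIn G Λ → ℕ) (B₁ B₂ : Finset V) {x f : V} (hff : θ f = f) :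
    h.srcOf n₀ (B₁ ∆ ({x} ∆ {f})) (B₂ ∆ ({x} ∆ {f})) = h.srcOf n₀ B₁ B₂ ∆ ({x} ∆ {θ x}) := by
  simp only [srcOf]
  rw [Finset.image_symmDiff _ _ θ.injective, Finset.image_symmDiff _ _ θ.injective, image_singleton,
    image_singleton, hff]
  -- symmetric-difference algebra: `({x} ∆ {f}) ∆ ({θx} ∆ {f}) = {x} ∆ {θx}`
  have key : (({x} : Finset V) ∆ {f}) ∆ ({θ x} ∆ {f}) = {x} ∆ {θ x} := by
    rw [symmDiff_assoc, symmDiff_comm ({f} : Finset V) ({θ x} ∆ {f}), symmDiff_assoc, symmDiff_self,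
      symmDiff_bot]
  rw [show csources G Λ n₀ ∆ (B₁ ∆ ({x} ∆ {f})) ∆ (B₂.image θ ∆ ({θ x} ∆ {f})) =
      csources G Λ n₀ ∆ B₁ ∆ B₂.image θ ∆ ((({x} : Finset V) ∆ {f}) ∆ ({θ x} ∆ {f})) by
    simp only [symmDiff_assoc, symmDiff_left_comm], key]

/-- **Lemma 2.3 of Duminil-Copin–Panis 2025 (switching principle for reflected currents)**, in
generating-function form and for an arbitrary source predicate `𝒜` and `θ`-symmetric support
`E'`: for `x ∈ H₋` and `β ≥ 0`,
`∑ₙ 𝟙[𝒜(∂n), n ⊆ E'] w(n) 𝟙[x ↔ Fix in fold n] = ∑ₙ 𝟙[𝒜(∂n ∆ {x} ∆ {θx}), n ⊆ E'] w(n) 𝟙[x ↔ Fix in fold n]`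
("`Z^A_{Λ,β}[x ↔_ℳ ℍ] = Z^{A Δ {x,𝓡(x)}}_{Λ,β}[x ↔_ℳ ℍ]`" is the case `𝒜 = (· = A)`,
`E' = ℰ_Λ`). Proof as printed: resum over the folded multigraph (`tsum_fold_key`), switch the
sources of the sub-current along a charged path from `x` to a fixed vertex
(`switchCount_eq_of_cconn`), and observe that this shifts the sources of the recombined current by
`{x, θx}` (`srcOf_switch`). [cite: DuminilCopinPanis2025LowerBounds, Lemma 2.3] -/
theorem tsum_switch_reflected (𝒜 : Finset V → Prop) {E' : Finset (Sym2 V)}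
    (hE' : ∀ e ∈ edgesIn G Λ, e ∈ E' ↔ Sym2.map θ e ∈ E') {x : V} (hx : x ∈ Hm) {β : ℝ} (hβ : 0 ≤ β) :
    ∑' n, ind (𝒜 (csources G Λ n) ∧ CSupp G Λ E' n) * cweight G Λ β n * ind (h.ConnFix (h.fold n) x) =
      ∑' n, ind (𝒜 (csources G Λ n ∆ ({x} ∆ {θ x})) ∧ CSupp G Λ E' n) * cweight G Λ β n *
        ind (h.ConnFix (h.fold n) x) := by
  classical
  rw [h.tsum_fold_key 𝒜 hE' x hβ, h.tsum_fold_key (fun C => 𝒜 (C ∆ ({x} ∆ {θ x}))) hE' x hβ]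
  refine tsum_congr fun n₀ => ?_
  congr 1
  refine tsum_congr fun m => ?_
  congr 1
  by_cases hc : CSupp G Λ (h.leftEdges ∩ E') m ∧ h.ConnFix m x
  · rw [ind_of_true hc, one_mul, one_mul]
    obtain ⟨f, hfΛ, hff, hconn⟩ := hc.2
    have hconn' : CConn G Λ m (h.leftEdges ∩ E') x f := cconn_of_csupp hc.1 hconn
    set D : Finset V := {x} ∆ {f} with hD
    have hDΛ : D ⊆ Λ := by
      intro v hv
      rw [hD, mem_symmDiff, mem_singleton, mem_singleton] at hv
      rcases hv with ⟨rfl, -⟩ | ⟨rfl, -⟩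
      · exact h.left_subset hx
      · exact hfΛ
    have hsc : ∀ B, switchCount G Λ m (h.leftEdges ∩ E') B =
        switchCount G Λ m (h.leftEdges ∩ E') (B ∆ D) := fun B => switchCount_eq_of_cconn m hconn' B
    have hmaps : ∀ B ∈ Λ.powerset, B ∆ D ∈ Λ.powerset := fun B hB => by
      rw [mem_powerset] at hB ⊢
      exact (symmDiff_subset_union (s := B) (t := D)).trans (union_subset hB hDΛ)
    calc ∑ B ∈ Λ.powerset, ind (𝒜 (h.srcOf n₀ (csources G Λ m ∆ B) B)) * switchCount G Λ m (h.leftEdges ∩ E') B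
        = ∑ B ∈ Λ.powerset, ind (𝒜 (h.srcOf n₀ (csources G Λ m ∆ B) B)) *
            switchCount G Λ m (h.leftEdges ∩ E') (B ∆ D) := sum_congr rfl fun B _ => by rw [hsc B]
      _ = ∑ B ∈ Λ.powerset, ind (𝒜 (h.srcOf n₀ (csources G Λ m ∆ (B ∆ D)) (B ∆ D))) *
            switchCount G Λ m (h.leftEdges ∩ E') B := by
          refine Finset.sum_nbij' (fun B => B ∆ D) (fun B => B ∆ D) hmaps hmaps
            (fun B _ => symmDiff_symmDiff_cancel_right _ _) (fun B _ => symmDiff_symmDiff_cancel_right _ _)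
            (fun B _ => ?_)
          rw [symmDiff_symmDiff_cancel_right]
      _ = ∑ B ∈ Λ.powerset, ind (𝒜 (h.srcOf n₀ (csources G Λ m ∆ B) B ∆ ({x} ∆ {θ x}))) *
            switchCount G Λ m (h.leftEdges ∩ E') B := by
          refine sum_congr rfl fun B _ => ?_
          rw [← symmDiff_assoc, hD, h.srcOf_switch n₀ _ _ hff]
  · rw [ind_of_false hc, zero_mul, zero_mul]

/-- **Lemma 2.3 with prescribed sources** (the printed form): for `A` and `x ∈ H₋`,
`Z^A_{E'}[x ↔ Fix in fold] = Z^{A ∆ {x} ∆ {θx}}_{E'}[x ↔ Fix in fold]`.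
[cite: DuminilCopinPanis2025LowerBounds, Lemma 2.3] -/
theorem tsum_switch_reflected_eq (A : Finset V) {E' : Finset (Sym2 V)}
    (hE' : ∀ e ∈ edgesIn G Λ, e ∈ E' ↔ Sym2.map θ e ∈ E') {x : V} (hx : x ∈ Hm) {β : ℝ} (hβ : 0 ≤ β) :
    ∑' n, ind (csources G Λ n = A ∧ CSupp G Λ E' n) * cweight G Λ β n * ind (h.ConnFix (h.fold n) x) =
      ∑' n, ind (csources G Λ n = A ∆ ({x} ∆ {θ x}) ∧ CSupp G Λ E' n) * cweight G Λ β n *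
        ind (h.ConnFix (h.fold n) x) := by
  rw [h.tsum_switch_reflected (· = A) hE' hx hβ]
  refine tsum_congr fun n => ?_
  rw [ind_congr (and_congr_left fun _ => ?_)]
  constructor
  · intro hA; rw [← hA, symmDiff_symmDiff_cancel_right]
  · intro hA; rw [hA, symmDiff_symmDiff_cancel_right]

end Switching

/-! ### Handshake: a lone left source is connected to the hyperplane in the fold -/

section Handshake

variable (h : IsFoldable G θ Λ Hm)

/-- **Handshake in a cluster.** For any current `m`, a vertex `a ∈ Λ` of odd `m`-degree is
connected through charged edges to another vertex of `Λ` of odd `m`-degree (the degree sum over the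
cluster of `a` is even: every charged edge has both or none of its endpoints in the cluster).
[folklore] -/
theorem exists_odd_cconn (m : edgesIn G Λ → ℕ) {a : V} (ha : a ∈ Λ) (hodd : Odd (cdeg G Λ m a)) :
    ∃ v ∈ Λ, v ≠ a ∧ Odd (cdeg G Λ m v) ∧ CConn G Λ m (edgesIn G Λ) a v := by
  classical
  set C : Finset V := Λ.filter (fun v => CConn G Λ m (edgesIn G Λ) a v) with hC
  have heven : Even (∑ v ∈ C, cdeg G Λ m v) := by
    unfold cdeg
    rw [sum_comm]
    refine Finset.even_sum _ fun e _ => ?_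
    rw [← sum_filter, sum_const, smul_eq_mul]
    by_cases hne : m e = 0
    · simp [hne]
    · have hpos : 0 < m e := Nat.pos_of_ne_zero hne
      obtain ⟨e, he⟩ := e
      induction e using Sym2.ind with
      | _ x y =>
        obtain ⟨hadj, hmem⟩ := mem_edgesIn_iff.1 he
        have hxy : x ≠ y := G.ne_of_adj ((SimpleGraph.mem_edgeSet G).1 hadj)
        have hiff : x ∈ C ↔ y ∈ C := by
          simp only [hC, mem_filter]
          rw [CConn.edge_iff (m := m) (E' := edgesIn G Λ) (e := ⟨s(x, y), he⟩) he hpos rfl a]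
          exact ⟨fun h => ⟨hmem y (Sym2.mem_mk_right x y), h.2⟩,
            fun h => ⟨hmem x (Sym2.mem_mk_left x y), h.2⟩⟩
        by_cases hx : x ∈ C
        · have hy : y ∈ C := hiff.1 hx
          have : C.filter (fun v => v ∈ (s(x, y) : Sym2 V)) = {x, y} := by
            ext v
            simp only [mem_filter, Sym2.mem_iff, mem_insert, mem_singleton]
            constructor
            · exact fun h => h.2
            · intro h
              exact ⟨h.elim (fun h => h ▸ hx) (fun h => h ▸ hy), h⟩
          rw [this, card_pair hxy]
          exact ⟨m ⟨s(x, y), he⟩, by ring⟩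
        · have hy : y ∉ C := fun h => hx (hiff.2 h)
          have : C.filter (fun v => v ∈ (s(x, y) : Sym2 V)) = ∅ := by
            refine filter_eq_empty_iff.2 fun v hv hmemv => ?_
            rcases Sym2.mem_iff.1 hmemv with rfl | rfl
            · exact hx hv
            · exact hy hv
          rw [this, card_empty]
          simp
  rw [even_sum_iff_even_card_odd] at heven
  have haC : a ∈ C.filter (fun v => Odd (cdeg G Λ m v)) :=
    mem_filter.2 ⟨mem_filter.2 ⟨ha, Relation.ReflTransGen.refl⟩, hodd⟩
  by_contra hcon
  push Not at hcon
  have hsingle : C.filter (fun v => Odd (cdeg G Λ m v)) = {a} := by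
    refine eq_singleton_iff_unique_mem.2 ⟨haC, fun v hv => ?_⟩
    obtain ⟨hvC, hvodd⟩ := mem_filter.1 hv
    obtain ⟨hvΛ, hvconn⟩ := mem_filter.1 hvC
    by_contra hva
    exact hcon v hvΛ hva hvodd hvconn
  rw [hsingle, card_singleton] at heven
  exact Nat.not_even_one heven

/-- Degrees of the left restriction at a vertex of `H₋` are the full degrees (every edge at such a
vertex is a left edge). [folklore] -/
theorem cdeg_crestrict_left_of_mem (n : edgesIn G Λ → ℕ) {v : V} (hv : v ∈ Hm) :
    cdeg G Λ (crestrict h.leftEdges n) v = cdeg G Λ n v := by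
  unfold cdeg crestrict
  refine sum_congr rfl fun e _ => ?_
  by_cases hve : v ∈ (e : Sym2 V)
  · rw [if_pos hve, if_pos hve, if_pos ((h.mem_leftEdges e).2 ⟨v, hv, hve⟩)]
  · rw [if_neg hve, if_neg hve]

/-- Degrees of the left restriction vanish on `θ H₋` (no left edge touches the right half).
[folklore] -/
theorem cdeg_crestrict_left_of_mem_right (n : edgesIn G Λ → ℕ) {v : V} (hv : θ v ∈ Hm) :
    cdeg G Λ (crestrict h.leftEdges n) v = 0 := by
  unfold cdeg crestrict
  refine sum_eq_zero fun e _ => ?_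
  by_cases hve : v ∈ (e : Sym2 V)
  · rw [if_pos hve, if_neg]
    intro hle
    obtain ⟨x, hx, hxe⟩ := (h.mem_leftEdges e).1 hle
    have hvx : v ≠ x := fun hvx => h.left_disjoint x hx (hvx ▸ hv)
    -- `e = {x, v}` with `x ∈ H₋` adjacent to `v`, `θ v ∈ H₋`: excluded
    obtain ⟨e, he⟩ := e
    have hadj : G.Adj x v := by
      have he' := (mem_edgesIn_iff.1 he).1
      have : (e : Sym2 V) = s(x, v) := (Sym2.mem_and_mem_iff hvx.symm).1 ⟨hxe, hve⟩
      rw [this] at he'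
      exact (SimpleGraph.mem_edgeSet G).1 he'
    exact h.no_cross x hx v hadj hv
  · rw [if_neg hve]

/-- The fold dominates the left restriction. [folklore] -/
theorem crestrict_left_le_fold (n : edgesIn G Λ → ℕ) (e : edgesIn G Λ) :
    crestrict h.leftEdges n e ≤ h.fold n e := by
  simp only [crestrict, fold]
  by_cases hl : IsLeft Hm (e : Sym2 V)
  · rw [if_pos ((h.mem_leftEdges e).2 hl), if_pos hl]; exact Nat.le_add_right _ _
  · rw [if_neg (fun hm => hl ((h.mem_leftEdges e).1 hm)), if_neg hl]

/-- **Handshake for reflected currents.** If the only source of `n` in the strict left half is `u`,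
then `u` is connected to the hyperplane in the folded current (the cluster of `u` in `𝒩₋` contains
an even number of odd vertices, the other ones lie on `ℍ`; this is the fact
"`Z^{{0,𝓡(0)}}_{Λ,β}[0 ↔_ℳ ℍ] = Z^{{0,𝓡(0)}}_{Λ,β}`" used in the proof of DCP Lemma 2.4, and
"`Z^{{y,𝓡(y)}}_{Λ∖S,β}[y ↔_ℳ ℍ] = Z^{{y,𝓡(y)}}_{Λ∖S,β}`" in the proof of Lemma 2.5).
[cite: DuminilCopinPanis2025LowerBounds, Lemma 2.4 (proof) and Lemma 2.5 (proof)] -/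
theorem connFix_fold_of_sources (n : edgesIn G Λ → ℕ) {u : V} (hu : u ∈ Hm)
    (hsrc : ∀ v ∈ Hm, v ∈ csources G Λ n ↔ v = u) : h.ConnFix (h.fold n) u := by
  classical
  set m : edgesIn G Λ → ℕ := crestrict h.leftEdges n with hm
  have huΛ : u ∈ Λ := h.left_subset hu
  have huodd : Odd (cdeg G Λ m u) := by
    rw [hm, h.cdeg_crestrict_left_of_mem n hu]
    exact (mem_filter.1 ((hsrc u hu).2 rfl)).2
  obtain ⟨v, hvΛ, hvu, hvodd, hvconn⟩ := exists_odd_cconn m huΛ huodd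
  -- `v` is fixed
  have hvfix : θ v = v := by
    by_contra hne
    rcases h.cover v hvΛ hne with hvm | hvr
    · rw [hm, h.cdeg_crestrict_left_of_mem n hvm] at hvodd
      exact hvu ((hsrc v hvm).1 (mem_filter.2 ⟨hvΛ, hvodd⟩))
    · rw [hm, h.cdeg_crestrict_left_of_mem_right n hvr] at hvodd
      exact Nat.not_odd_zero hvodd
  exact ⟨v, hvΛ, hvfix, CConn.mono (h.crestrict_left_le_fold n) hvconn⟩

end Handshake

end IsFoldable

end Literature.Probability.LatticeModels
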